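import Literature.NumberTheory.IwasawaTheory.NarrowFukudaRankProofs
import Literature.NumberTheory.IwasawaTheory.Fukuda1994Thm1RankProofs
import HarnessLib

/-!
# Fukuda's layers: the `p`-ranks of the (narrow) class groups are NON-DECREASING above the index `n₀`, and the converse of
# Theorem 1 (2) — bounded ranks (`μ = 0`) force a stabilising pair `rank A_{m+1} = rank A_m`

Topic `NumberTheory/IwasawaTheory` (namespace = path). THEOREM-ONLY file (no definition, no named fact, no `sorry`), written by the prover seat
`cruxlead-stmt-BirchSwinnertonDyer-19573-w2` GEN 11 (cell `bsd-2adic`; `--supports` stmt-BirchSwinnertonDyer-19573; closes nothing).  Sequel of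
`FukudaRankGrowthSteps` / `Fukuda1994Thm1RankProofs` (seat `bsd-potss-k8t-c4` g20: Fukuda's Theorem 1 (2) at finite level) and of this seat's
`NarrowFukudaRankProofs` (GEN 9: the same for NARROW class groups).

THE POINT.  In the group-theoretic setting of `FukudaGroupLayers` (`G = Gal(H/K_n)` finite, `A ◁ G` abelian of index `p^t`, `A⟨g⟩ = G`, the «inertia»
family `𝓘`, `φ = conjEnd A g`, `Y₀ = (G'·⟨𝓘⟩) ∩ A`, `ν_j = Σ_{i<p^j} φ^i`) the tree has, for every layer `G_j ⊇ A` of index `p^j`, the cardinality identity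
`[G_j : N_jP_j] · #(ν_j Y₀ + pA) = #A` (`relIndex_commutator_sup_layer_pow_mul_card`; «`A_{n+j}/p ≅ X/(ν_{n,j}Y + pX)`»).  Since `ν_k = (Σ_{i<p^{k−j}} (φ^{p^j})^i) ∘ ν_j`
and `Y₀` is `φ`-stable, **`ν_k Y₀ ⊆ ν_j Y₀` for `j ≤ k`**, so `#(ν_k Y₀ + pA) ∣ #(ν_j Y₀ + pA)` and therefore **`[G_j : N_jP_j] ∣ [G_k : N_kP_k]`**: the `p`-rank of
the `j`-th layer divides (as an index, i.e. is at most as a rank) that of the `k`-th.  Read through the two packages (`Fukuda.exists_layer_package`, wide;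
`NarrowFukuda.exists_layer_package`, narrow): for a `ℤ_p`-extension `κ` with Fukuda index `n₀`, the `p`-ranks `rank_p Cl(K_m)` and `rank_p Cl⁺(K_m)` are
NON-DECREASING for `m ≥ n₀` (the norm `A_{m+1} → A_m` is onto once `K_{m+1}/K_m` is totally ramified somewhere — here in its finite shadow).  Consequently the
converse of Fukuda's Theorem 1 (2) holds: **bounded `p`-ranks ⟹ two consecutive layers `m, m+1` (`m ≥ n₀`, indeed `m ≤ n₀ + B`) with equal `p`-rank** — so «some rung
of the rank certificate fires» is EQUIVALENT to «`p`-ranks bounded» (wide: to `μ = 0`, `classicalMuVanishes_iff_exists_forall_classGroupPRank_le`).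

* §1 (`FukudaGroup`) `map_geom_sum_le_of_dvd` (`ν_b W ⊆ ν_a W` for `a ∣ b`, `W` `φ`-stable), **`relIndex_commutator_sup_pow_dvd`** (`[G_j : N_jP_j] ∣ [G_k : N_kP_k]`, `j ≤ k ≤ t`).
* §2 (wide) **`Fukuda.classGroupPRank_le_succ`** (`n₀ ≤ n ⟹ r_n ≤ r_{n+1}`), `Fukuda.classGroupPRank_mono`, **`Fukuda.exists_classGroupPRank_succ_eq_of_forall_le`**
  (bounded ⟹ stabilising pair), ★ **`Fukuda.classicalMuVanishes_iff_exists_classGroupPRank_succ_eq`** (`μ = 0 ⟺ ∃ m ≥ n₀, r_{m+1} = r_m`).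
* §3 (narrow) **`NarrowFukuda.index_range_pow_narrowClassGroup_dvd_succ`** (`[Cl⁺(K_n):(Cl⁺)^p] ∣ [Cl⁺(K_{n+1}):(Cl⁺)^p]`, `n ≥ n₀`, any `NumberField` instances),
  `…_dvd_add`, **`NarrowFukuda.exists_succ_eq_of_forall_padicValNat_le`** (bounded narrow ranks ⟹ stabilising pair), ★
  **`NarrowFukuda.exists_forall_padicValNat_le_iff_exists_succ_eq`** («narrow ranks bounded ⟺ some rung of the narrow rank certificate fires»).

Reading for the cell: the narrow rank certificate of this seat (GEN 9–11: `NarrowFukuda.narrowMu_of_…`, the rung doors) is COMPLETE for «`μ(X⁺) = 0`» — climbing the rungs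
`m = n₀, n₀+1, …` is a semi-decision procedure that terminates iff the narrow `2`-ranks are bounded; a JUMP at a pair means a strictly larger rank.  Nothing is asserted
about any field.  BSD is not proved by any of this.

References: [Fukuda1994] T. Fukuda, *Remarks on ℤ_p-extensions of number fields*, Proc. Japan Acad. 70 A (1994), Thm. 1 (2) and proof, p. 264; [Washington1997] §13.3
Lemma 13.15 (the norm `X_{n+1} → X_n` is onto), Lemma 13.18, Prop. 13.22–13.23; [NeukirchANT1999] Ch. VI §6 Prop. (6.8).
-/

set_option autoImplicit false

noncomputable section

open Subgroup Finset Polynomial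
open scoped IsMulCommutative NumberField

/-! ## §1 The group-theoretic monotonicity `[G_j : N_jP_j] ∣ [G_k : N_kP_k]` -/

namespace Literature.NumberTheory.IwasawaTheory.FukudaGroup

variable {G : Type*} [Group G] {A : Subgroup G} [A.Normal] [IsMulCommutative A] [Finite G] {p : ℕ} [hp : Fact p.Prime]
  {g : G} {𝓘 : Set (Subgroup G)} {t : ℕ}

omit [A.Normal] [IsMulCommutative A] [Finite G] hp in
/-- `∑_{i<mn} φ^i = (∑_{j<n} (φ^m)^j)·(∑_{i<m} φ^i)` (re-proved; private in `FukudaRankGrowthSteps`). [folklore] -/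
private theorem geom_sum_mul_eq' {M : Type*} [AddCommGroup M] (φ : Module.End ℤ M) (m n : ℕ) :
    ∑ i ∈ range (m * n), φ ^ i = (∑ j ∈ range n, (φ ^ m) ^ j) * ∑ i ∈ range m, φ ^ i := by
  have h : ∑ i ∈ range (m * n), (X : ℤ[X]) ^ i = (∑ j ∈ range n, ((X : ℤ[X]) ^ m) ^ j) * ∑ i ∈ range m, (X : ℤ[X]) ^ i := by
    induction n with
    | zero => simp
    | succ n ih =>
      rw [Nat.mul_succ, Finset.sum_range_add, ih, Finset.sum_range_succ, add_mul]
      congr 1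
      rw [Finset.mul_sum]
      exact Finset.sum_congr rfl fun i _ => by ring
  have h2 := congrArg (aeval φ) h
  simp only [map_sum, map_mul, map_pow, aeval_X] at h2
  exact h2

omit [A.Normal] [IsMulCommutative A] [Finite G] hp in
/-- `φ^n w ∈ W` for `w` in a `φ`-stable `W`. [folklore] -/
private theorem pow_apply_mem'' {M : Type*} [AddCommGroup M] (φ : Module.End ℤ M) (W : Submodule ℤ M) (hW : ∀ w ∈ W, φ w ∈ W)
    (n : ℕ) {w : M} (hw : w ∈ W) : (φ ^ n) w ∈ W := by
  induction n generalizing w with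
  | zero => simpa using hw
  | succ n ih => rw [pow_succ, Module.End.mul_apply]; exact ih (hW w hw)

omit [A.Normal] [IsMulCommutative A] [Finite G] hp in
/-- `(∑_{i<m} ψ^i) w ∈ W` for `w` in a `ψ`-stable `W`. [folklore] -/
private theorem geom_sum_apply_mem' {M : Type*} [AddCommGroup M] (ψ : Module.End ℤ M) (W : Submodule ℤ M)
    (hW : ∀ w ∈ W, ψ w ∈ W) (m : ℕ) {w : M} (hw : w ∈ W) : (∑ i ∈ range m, ψ ^ i) w ∈ W := by
  rw [LinearMap.sum_apply]
  exact W.sum_mem fun i _ => pow_apply_mem'' ψ W hW i hw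

omit [A.Normal] [IsMulCommutative A] [Finite G] hp in
/-- **`ν_b(W) ⊆ ν_a(W)` for `a ∣ b` and a `φ`-stable submodule `W`** (`ν_c = ∑_{i<c} φ^i`; `ν_b = (∑_{j<b/a} (φ^a)^j) ∘ ν_a` and `ν_a(W)` is `φ`-stable).
In Fukuda's setting: `ν_{n,k} Y ⊆ ν_{n,j} Y` for `j ≤ k`. [cite: Washington1997, §13.3 Lemma 13.18 (`ν_{n+1} = ν_n·(1 + γ^{p^n} + ⋯)`)] -/
theorem map_geom_sum_le_of_dvd {M : Type*} [AddCommGroup M] (φ : Module.End ℤ M) (W : Submodule ℤ M) (hW : ∀ w ∈ W, φ w ∈ W)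
    {a b : ℕ} (hab : a ∣ b) :
    W.map (∑ i ∈ range b, φ ^ i) ≤ W.map (∑ i ∈ range a, φ ^ i) := by
  obtain ⟨c, rfl⟩ := hab
  rintro _ ⟨w, hw, rfl⟩
  rw [geom_sum_mul_eq' φ a c, Module.End.mul_apply]
  -- `ν_a(W)` is `φ`-stable, hence `φ^a`-stable
  have hstab : ∀ x ∈ W.map (∑ i ∈ range a, φ ^ i), (φ ^ a) x ∈ W.map (∑ i ∈ range a, φ ^ i) := by
    rintro _ ⟨x, hx, rfl⟩
    refine ⟨(φ ^ a) x, pow_apply_mem'' φ W hW a hx, ?_⟩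
    have hcomm : Commute (φ ^ a) (∑ i ∈ range a, φ ^ i) :=
      Commute.sum_right _ _ _ fun i _ => Commute.pow_pow_self φ a i
    rw [← Module.End.mul_apply, ← hcomm.eq, Module.End.mul_apply]
  exact geom_sum_apply_mem' (φ ^ a) _ hstab c ⟨w, hw, rfl⟩

/-- **RANK MONOTONICITY ALONG FUKUDA'S LAYERS: `[G_j : N_jP_j] ∣ [G_k : N_kP_k]` for `j ≤ k ≤ t`** (`G_j ⊇ A` of index `p^j`, `N_j = G_j'·⟨I ∩ G_j⟩`,
`P_j = ⟨x^p : x ∈ G_j⟩`).  From `[G_j : N_jP_j]·#(ν_jY₀ + pA) = #A` (`relIndex_commutator_sup_layer_pow_mul_card`) at `j` and at `k` and `ν_kY₀ + pA ⊆ ν_jY₀ + pA`.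
In the application `[G_j : N_jP_j] = p^{rank_p A_{n+j}}`: the `p`-ranks of the layers do not decrease (the finite shadow of «`X → A_n` onto, `A_n/p ≅ X/(ν_nY + pX)` with
`ν_nY` decreasing»). [cite: Washington1997, §13.3 Lemmas 13.15 and 13.18] [cite: Fukuda1994, Thm. 1 (2), p. 264 (proof)] -/
theorem relIndex_commutator_sup_pow_dvd (hgA : Subgroup.zpowers g ⊓ A = ⊥) (hgen : A ⊔ Subgroup.zpowers g = ⊤)
    (hind : A.index = p ^ t) (h𝓘 : ∀ I ∈ 𝓘, I ⊓ A = ⊥ ∧ (I = ⊥ ∨ I ⊔ A = ⊤)) (hg𝓘 : Subgroup.zpowers g ∈ 𝓘)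
    {j k : ℕ} (hjk : j ≤ k) (hk : k ≤ t) {Gj Gk : Subgroup G} (hAGj : A ≤ Gj) (hGj : Gj.index = p ^ j)
    (hAGk : A ≤ Gk) (hGk : Gk.index = p ^ k) :
    ((⁅Gj, Gj⁆ ⊔ ⨆ I ∈ 𝓘, I ⊓ Gj) ⊔ Subgroup.closure ((fun x : G => x ^ p) '' (Gj : Set G))).relIndex Gj ∣
      ((⁅Gk, Gk⁆ ⊔ ⨆ I ∈ 𝓘, I ⊓ Gk) ⊔ Subgroup.closure ((fun x : G => x ^ p) '' (Gk : Set G))).relIndex Gk := by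
  classical
  have hj := relIndex_commutator_sup_layer_pow_mul_card hgA hgen hind h𝓘 hg𝓘 (hjk.trans hk) hAGj hGj
  have hk' := relIndex_commutator_sup_layer_pow_mul_card hgA hgen hind h𝓘 hg𝓘 hk hAGk hGk
  set Y₀ : Submodule ℤ (Additive A) := subOf A (⁅(⊤ : Subgroup G), ⊤⁆ ⊔ ⨆ I ∈ 𝓘, I) with hY₀
  set Q : Submodule ℤ (Additive A) := (⊤ : Submodule ℤ (Additive A)).map ((p : ℤ) • (1 : Module.End ℤ (Additive A))) with hQ
  set Wj : Submodule ℤ (Additive A) := Y₀.map (∑ i ∈ range (p ^ j), conjEnd A g ^ i) ⊔ Q with hWj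
  set Wk : Submodule ℤ (Additive A) := Y₀.map (∑ i ∈ range (p ^ k), conjEnd A g ^ i) ⊔ Q with hWk
  have hstab : ∀ y ∈ Y₀, conjEnd A g y ∈ Y₀ := fun y hy => conjEnd_mem_subOf_commutator_sup hgA hgen hind h𝓘 hg𝓘 hy
  have hle : Wk ≤ Wj := sup_le_sup_right (map_geom_sum_le_of_dvd (conjEnd A g) Y₀ hstab (pow_dvd_pow p hjk)) Q
  have hdvd : Nat.card Wk ∣ Nat.card Wj := AddSubgroup.card_dvd_of_le (H := Wk.toAddSubgroup) (K := Wj.toAddSubgroup) hle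
  obtain ⟨c, hc⟩ := hdvd
  have hpos : 0 < Nat.card Wk := Nat.card_pos
  refine ⟨c, Nat.eq_of_mul_eq_mul_right hpos ?_⟩
  -- `r_k · #W_k = #A = r_j · #W_j = r_j · c · #W_k`
  calc ((⁅Gk, Gk⁆ ⊔ ⨆ I ∈ 𝓘, I ⊓ Gk) ⊔ Subgroup.closure ((fun x : G => x ^ p) '' (Gk : Set G))).relIndex Gk * Nat.card Wk
        = Nat.card A := hk'
    _ = ((⁅Gj, Gj⁆ ⊔ ⨆ I ∈ 𝓘, I ⊓ Gj) ⊔ Subgroup.closure ((fun x : G => x ^ p) '' (Gj : Set G))).relIndex Gj * Nat.card Wj := hj.symm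
    _ = _ := by rw [hc]; ring

end Literature.NumberTheory.IwasawaTheory.FukudaGroup

namespace Literature.NumberTheory.IwasawaTheory

open Literature.NumberTheory.EllipticCurves Literature.NumberTheory.NumberFields Literature.NumberTheory.GaloisRepresentations

variable {K : Type} [Field K] [NumberField K] {p : ℕ} [hp : Fact p.Prime]

/-- `a ∣ b ≠ 0 ⟹ ord_p a ≤ ord_p b`. [folklore] -/
private theorem padicValNat_le_of_dvd' {a b : ℕ} (hb : b ≠ 0) (h : a ∣ b) : padicValNat p a ≤ padicValNat p b :=
  (padicValNat_dvd_iff_le hb).1 (pow_padicValNat_dvd.trans h)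

/-- A non-decreasing `g : ℕ → ℕ` without two consecutive equal values on `[0, B]` grows by at least `k` in `k ≤ B + 1` steps. [folklore] -/
private theorem add_le_of_forall_ne {g : ℕ → ℕ} (hmono : ∀ k, g k ≤ g (k + 1)) {B : ℕ} (hne : ∀ k, k ≤ B → g k ≠ g (k + 1)) :
    ∀ k, k ≤ B + 1 → g 0 + k ≤ g k := by
  intro k
  induction k with
  | zero => intro _; simp
  | succ k ih =>
    intro hk
    have h1 := ih (by omega)
    have h2 : g k < g (k + 1) := lt_of_le_of_ne (hmono k) (hne k (by omega))
    omega

/-- A non-decreasing `g : ℕ → ℕ` bounded by `B` has two consecutive equal values at some `k ≤ B`. [folklore] -/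
private theorem exists_succ_eq_of_mono_of_le {g : ℕ → ℕ} (hmono : ∀ k, g k ≤ g (k + 1)) {B : ℕ} (hB : ∀ k, g k ≤ B) :
    ∃ k, k ≤ B ∧ g (k + 1) = g k := by
  by_contra h
  have hne : ∀ k, k ≤ B → g k ≠ g (k + 1) := fun k hk heq => h ⟨k, hk, heq.symm⟩
  have h1 := add_le_of_forall_ne hmono hne (B + 1) le_rfl
  have h2 := hB (B + 1)
  omega

/-! ## §2 Wide class groups: `rank_p Cl(K_m)` is non-decreasing for `m ≥ n₀`; `μ = 0 ⟺` a stabilising pair -/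

/-- **`rank_p Cl(K_n) ≤ rank_p Cl(K_{n+1})` for `n ≥ n₀`** (Fukuda index `n₀`): the finite shadow of the surjectivity of the norm `A_{n+1} → A_n` in a layer
totally ramified at some prime (`p^{r_n} = [G₀ : N₀P₀] ∣ [G₁ : N₁P₁] = p^{r_{n+1}}`, §1 on the wide package). [cite: Washington1997, §13.3 Lemma 13.15]
[cite: Fukuda1994, Thm. 1 (2), p. 264 (proof)] -/
theorem Fukuda.classGroupPRank_le_succ (κ : ZpExtension K p) {n₀ n : ℕ} (hκ : TotallyRamifiedFrom κ n₀) (hn : n₀ ≤ n) :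
    classGroupPRank κ n ≤ classGroupPRank κ (n + 1) := by
  classical
  obtain ⟨G, _instG, _instF, A', hA'n, _instC, g, 𝓘, hgA, hgen, hA'index, h𝓘, hg𝓘, -, hlayer⟩ :=
    exists_layer_package κ hκ hn 1 le_rfl
  obtain ⟨G₀, hAG₀, hG₀, -, hr₀⟩ := hlayer 0 (Nat.zero_le 1)
  obtain ⟨G₁, hAG₁, hG₁, -, hr₁⟩ := hlayer 1 le_rfl
  rw [add_zero] at hr₀
  have h := FukudaGroup.relIndex_commutator_sup_pow_dvd hgA hgen hA'index h𝓘 hg𝓘 (Nat.zero_le 1) le_rfl hAG₀ hG₀ hAG₁ hG₁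
  rw [hr₀, hr₁] at h
  exact (Nat.pow_dvd_pow_iff_le_right hp.out.one_lt).mp h

/-- **`rank_p Cl(K_m)` is non-decreasing on `m ≥ n₀`.** [cite: Washington1997, §13.3 Lemma 13.15] [cite: Fukuda1994, Thm. 1 (2), p. 264 (proof)] -/
theorem Fukuda.classGroupPRank_mono (κ : ZpExtension K p) {n₀ n m : ℕ} (hκ : TotallyRamifiedFrom κ n₀) (hn : n₀ ≤ n) (hnm : n ≤ m) :
    classGroupPRank κ n ≤ classGroupPRank κ m := by
  obtain ⟨d, rfl⟩ := Nat.exists_eq_add_of_le hnm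
  induction d with
  | zero => exact le_rfl
  | succ d ih =>
    exact (ih (Nat.le_add_right n d)).trans
      ((Fukuda.classGroupPRank_le_succ κ hκ (hn.trans (Nat.le_add_right n d))).trans_eq (by rw [Nat.add_assoc]))

/-- **Bounded ranks force a stabilising pair** (converse of Fukuda's Thm. 1 (2) at the level of ranks): if `rank_p Cl(K_m) ≤ B` for all `m` and `κ` has Fukuda index `n₀`,
then `rank_p Cl(K_{m+1}) = rank_p Cl(K_m)` for some `n₀ ≤ m ≤ n₀ + B` (a non-decreasing bounded sequence of naturals). [cite: Fukuda1994, Thm. 1 (2), p. 264]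
[cite: Washington1997, §13.3 Prop. 13.23] -/
theorem Fukuda.exists_classGroupPRank_succ_eq_of_forall_le (κ : ZpExtension K p) {n₀ B : ℕ} (hκ : TotallyRamifiedFrom κ n₀)
    (hB : ∀ m, classGroupPRank κ m ≤ B) : ∃ m, n₀ ≤ m ∧ m ≤ n₀ + B ∧ classGroupPRank κ (m + 1) = classGroupPRank κ m := by
  obtain ⟨k, hk, heq⟩ := exists_succ_eq_of_mono_of_le (g := fun k => classGroupPRank κ (n₀ + k))
    (fun k => by
      have h := Fukuda.classGroupPRank_le_succ κ hκ (Nat.le_add_right n₀ k)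
      rwa [Nat.add_assoc] at h) (B := B) (fun k => hB _)
  exact ⟨n₀ + k, Nat.le_add_right _ _, by omega, by rw [Nat.add_assoc]; exact heq⟩

/-- ★ **`μ = 0 ⟺ SOME PAIR OF CONSECUTIVE LAYERS ABOVE `n₀` HAS THE SAME `p`-RANK`** (Fukuda's Thm. 1 (2) and its converse, for a `ℤ_p`-extension with Fukuda index `n₀`):
`ClassicalMuVanishes κ` (growth form) ⟺ the `p`-ranks `rank_p Cl(K_m)` are bounded (tree `classicalMuVanishes_iff_exists_forall_classGroupPRank_le`) ⟺
`∃ m ≥ n₀, rank_p Cl(K_{m+1}) = rank_p Cl(K_m)` (⟸: Thm. 1 (2), tree `fukuda1994_thm1_classGroupPRank_const_of_succ_eq_holds`; ⟹: monotonicity, this file).  So the rank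
certificate («find a stabilising pair») is a COMPLETE semi-decision procedure for `μ = 0`. [cite: Fukuda1994, Thm. 1 (2), p. 264] [cite: Washington1997, §13.3 Prop. 13.22–13.23] -/
theorem Fukuda.classicalMuVanishes_iff_exists_classGroupPRank_succ_eq (κ : ZpExtension K p) {n₀ : ℕ} (hκ : TotallyRamifiedFrom κ n₀) :
    ClassicalMuVanishes κ ↔ ∃ m, n₀ ≤ m ∧ classGroupPRank κ (m + 1) = classGroupPRank κ m := by
  constructor
  · intro hμ
    obtain ⟨B, hB⟩ := (classicalMuVanishes_iff_exists_forall_classGroupPRank_le κ).mp hμ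
    obtain ⟨m, hm, -, heq⟩ := Fukuda.exists_classGroupPRank_succ_eq_of_forall_le κ hκ hB
    exact ⟨m, hm, heq⟩
  · rintro ⟨m, hm, heq⟩
    exact classicalMuVanishes_of_classGroupPRank_succ_eq' κ hκ hm heq

/-! ## §3 Narrow class groups: `rank_p Cl⁺(K_m)` is non-decreasing for `m ≥ n₀`; bounded narrow ranks ⟺ a stabilising pair -/

/-- **`[Cl⁺(K_n) : Cl⁺(K_n)^p] ∣ [Cl⁺(K_{n+1}) : Cl⁺(K_{n+1})^p]` for `n ≥ n₀`** — the narrow `p`-rank does not decrease in a layer above Fukuda's index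
(§1 on the NARROW package `NarrowFukuda.exists_layer_package`; any `NumberField` instances on the layers). [cite: Washington1997, §13.3 Lemma 13.15]
[cite: Fukuda1994, Thm. 1 (2), p. 264 (proof)] [cite: NeukirchANT1999, Ch. VI §6 Prop. (6.8)] -/
theorem NarrowFukuda.index_range_pow_narrowClassGroup_dvd_succ (κ : ZpExtension K p) {n₀ n : ℕ} (hκ : TotallyRamifiedFrom κ n₀) (hn : n₀ ≤ n)
    [NumberField (κ.layer n)] [NumberField (κ.layer (n + 1))] :
    (powMonoidHom (α := NarrowClassGroup (κ.layer n)) p).range.index ∣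
      (powMonoidHom (α := NarrowClassGroup (κ.layer (n + 1))) p).range.index := by
  classical
  obtain ⟨G, _instG, _instF, A', hA'n, _instC, g, 𝓘, hgA, hgen, hA'index, h𝓘, hg𝓘, hlayer⟩ :=
    NarrowFukuda.exists_layer_package κ hκ hn 1 le_rfl
  haveI : NumberField (κ.layer (n + 0)) := ‹NumberField (κ.layer n)›
  obtain ⟨G₀, hAG₀, hG₀, hr₀⟩ := hlayer 0 (Nat.zero_le 1)
  obtain ⟨G₁, hAG₁, hG₁, hr₁⟩ := hlayer 1 le_rfl
  have h := FukudaGroup.relIndex_commutator_sup_pow_dvd hgA hgen hA'index h𝓘 hg𝓘 (Nat.zero_le 1) le_rfl hAG₀ hG₀ hAG₁ hG₁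
  rw [hr₀, hr₁] at h
  exact h

/-- **`[Cl⁺(K_n) : Cl⁺(K_n)^p] ∣ [Cl⁺(K_{n+d}) : Cl⁺(K_{n+d})^p]` for `n ≥ n₀`** (iterate of the previous; any `NumberField` instances).
[cite: Washington1997, §13.3 Lemma 13.15] [cite: Fukuda1994, Thm. 1 (2), p. 264 (proof)] -/
theorem NarrowFukuda.index_range_pow_narrowClassGroup_dvd_add (κ : ZpExtension K p) {n₀ n : ℕ} (hκ : TotallyRamifiedFrom κ n₀) (hn : n₀ ≤ n)
    [NumberField (κ.layer n)] (d : ℕ) :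
    ∀ [NumberField (κ.layer (n + d))],
      (powMonoidHom (α := NarrowClassGroup (κ.layer n)) p).range.index ∣
        (powMonoidHom (α := NarrowClassGroup (κ.layer (n + d))) p).range.index := by
  induction d with
  | zero => intro _; exact dvd_refl _
  | succ d ih =>
    intro _
    haveI : FiniteDimensional K (κ.layer (n + d)) := κ.finiteDimensional_layer_holds (n + d)
    haveI : NumberField (κ.layer (n + d)) := NumberField.of_module_finite K _
    exact ih.trans (NarrowFukuda.index_range_pow_narrowClassGroup_dvd_succ κ hκ (hn.trans (Nat.le_add_right n d)))

/-- **Bounded narrow `p`-ranks force a stabilising pair**: if `κ` has Fukuda index `n₀` and `ord_p [Cl⁺(K_m) : Cl⁺(K_m)^p] ≤ B` for all `m` (any `NumberField` instance), then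
`[Cl⁺(K_{m+1}) : (Cl⁺)^p] = [Cl⁺(K_m) : (Cl⁺)^p]` for some `n₀ ≤ m ≤ n₀ + B` (for all `NumberField` instances) — the converse of NARROW FUKUDA (GEN 9's
`NarrowFukuda.index_range_pow_narrowClassGroup_eq_of_succ_eq`) at the level of ranks. [cite: Fukuda1994, Thm. 1 (2), p. 264] [cite: Washington1997, §13.3 Prop. 13.23] -/
theorem NarrowFukuda.exists_succ_eq_of_forall_padicValNat_le (κ : ZpExtension K p) {n₀ B : ℕ} (hκ : TotallyRamifiedFrom κ n₀)
    (hB : ∀ m : ℕ, ∀ [NumberField (κ.layer m)], padicValNat p (powMonoidHom (α := NarrowClassGroup (κ.layer m)) p).range.index ≤ B) :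
    ∃ m, n₀ ≤ m ∧ m ≤ n₀ + B ∧ ∀ [NumberField (κ.layer m)] [NumberField (κ.layer (m + 1))],
      (powMonoidHom (α := NarrowClassGroup (κ.layer (m + 1))) p).range.index =
        (powMonoidHom (α := NarrowClassGroup (κ.layer m)) p).range.index := by
  classical
  have hinst : ∀ j : ℕ, NumberField (κ.layer j) := fun j =>
    haveI : FiniteDimensional K (κ.layer j) := κ.finiteDimensional_layer_holds j
    NumberField.of_module_finite K _
  -- the index of each layer (a power of `p`) and its exponent, with the fixed instances
  let I : ℕ → ℕ := fun j => by
    haveI := hinst j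
    exact (powMonoidHom (α := NarrowClassGroup (κ.layer j)) p).range.index
  have hI0 : ∀ j, I j ≠ 0 := fun j => by
    haveI := hinst j
    haveI : Finite (NarrowClassGroup (κ.layer j)) := finite_rayClassGroup top_ne_bot
    exact Subgroup.index_ne_zero_of_finite
  have hIpow : ∀ j, ∃ c : ℕ, I j = p ^ c := fun j => by
    haveI := hinst j
    exact index_range_powMonoidHom_narrowClassGroup_eq_prime_pow (K := ↥(κ.layer j)) p
  have hmono : ∀ k, padicValNat p (I (n₀ + k)) ≤ padicValNat p (I (n₀ + k + 1)) := fun k => by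
    haveI := hinst (n₀ + k)
    haveI := hinst (n₀ + k + 1)
    exact padicValNat_le_of_dvd' (hI0 _) (NarrowFukuda.index_range_pow_narrowClassGroup_dvd_succ κ hκ (Nat.le_add_right n₀ k))
  obtain ⟨k, hk, heq⟩ := exists_succ_eq_of_mono_of_le (g := fun k => padicValNat p (I (n₀ + k)))
    (fun k => by have h := hmono k; rwa [Nat.add_assoc] at h) (B := B) (fun k => by haveI := hinst (n₀ + k); exact hB (n₀ + k))
  refine ⟨n₀ + k, Nat.le_add_right _ _, by omega, ?_⟩
  intro _ _
  -- equal exponents of `p` ⟹ equal indices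
  obtain ⟨c₁, hc₁⟩ := hIpow (n₀ + k + 1)
  obtain ⟨c₀, hc₀⟩ := hIpow (n₀ + k)
  have h1 : I (n₀ + k + 1) = (powMonoidHom (α := NarrowClassGroup (κ.layer (n₀ + k + 1))) p).range.index := rfl
  have h0 : I (n₀ + k) = (powMonoidHom (α := NarrowClassGroup (κ.layer (n₀ + k))) p).range.index := rfl
  rw [← h1, ← h0, hc₁, hc₀]
  have heq' : padicValNat p (I (n₀ + k + 1)) = padicValNat p (I (n₀ + k)) := by rw [Nat.add_assoc]; exact heq
  rw [hc₁, hc₀, padicValNat.prime_pow, padicValNat.prime_pow] at heq'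
  rw [heq']

/-- ★ **NARROW RANKS BOUNDED ⟺ SOME RUNG OF THE NARROW RANK CERTIFICATE FIRES** (for a `ℤ_p`-extension `κ` with Fukuda index `n₀`): the narrow `p`-ranks
`rank_p Cl⁺(K_m)` are bounded along the tower iff `rank_p Cl⁺(K_{m+1}) = rank_p Cl⁺(K_m)` for some `m ≥ n₀` (⟸: NARROW FUKUDA, GEN 9's
`NarrowFukuda.exists_forall_padicValNat_index_le_of_succ_eq`; ⟹: monotonicity).  At `p = 2` the left side is «`μ = 0` for the narrow Iwasawa module `X⁺`», the
hypothesis (a) ∧ (b) of the Kida-lite ascent; so the rung doors of this seat lose nothing. [cite: Fukuda1994, Thm. 1 (2), p. 264] [cite: Washington1997, §13.3 Prop. 13.22–13.23]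
[cite: GreenbergLNM1716, §5, proof of Prop. 5.14 (p. 122)] -/
theorem NarrowFukuda.exists_forall_padicValNat_le_iff_exists_succ_eq (κ : ZpExtension K p) {n₀ : ℕ} (hκ : TotallyRamifiedFrom κ n₀) :
    (∃ B : ℕ, ∀ m : ℕ, ∀ [NumberField (κ.layer m)], padicValNat p (powMonoidHom (α := NarrowClassGroup (κ.layer m)) p).range.index ≤ B) ↔
      ∃ m, n₀ ≤ m ∧ ∀ [NumberField (κ.layer m)] [NumberField (κ.layer (m + 1))],
        (powMonoidHom (α := NarrowClassGroup (κ.layer (m + 1))) p).range.index =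
          (powMonoidHom (α := NarrowClassGroup (κ.layer m)) p).range.index := by
  constructor
  · rintro ⟨B, hB⟩
    obtain ⟨m, hm, -, heq⟩ := NarrowFukuda.exists_succ_eq_of_forall_padicValNat_le κ hκ hB
    exact ⟨m, hm, heq⟩
  · rintro ⟨m, hm, heq⟩
    haveI : FiniteDimensional K (κ.layer m) := κ.finiteDimensional_layer_holds m
    haveI : FiniteDimensional K (κ.layer (m + 1)) := κ.finiteDimensional_layer_holds (m + 1)
    haveI : NumberField (κ.layer m) := NumberField.of_module_finite K _
    haveI : NumberField (κ.layer (m + 1)) := NumberField.of_module_finite K _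
    exact NarrowFukuda.exists_forall_padicValNat_index_le_of_succ_eq κ hκ hm heq

end Literature.NumberTheory.IwasawaTheory

end
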